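import Summits.BirchSwinnertonDyer.BirchSwinnertonDyer.Theorems.AdditiveKolyvaginRoadManinFrameResidueProperTwistDegree
import Literature.NumberTheory.EllipticCurves.SkinnerUrban2014.PAdicUnitImaginaryPeriodRatioProofs
import Literature.NumberTheory.EllipticCurves.KatoAdditiveTwistedValueNeronIntegrality
import HarnessLib

/-!
# Route `AdditiveKolyvaginRoad`, crux `ManinFrameResidueProperR` (stmt-BirchSwinnertonDyer-20709), line
# `birth`, stub TDS `stub_twistDegreeStep` (`p ≥ 11`): the EULER-SYSTEM LEVER — TDS at every residue frame
# whose optimal member carries ONE `p`-unit quadratic twist, GRANTED Kato's integral zeta elements read in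
# Néron units at an additive `p > 7` (Literature named fact) — `--supports`, helper

Cell `pub/bsd-wall` (D-0120, W-ALL row 2), seat `bsd-wall-manin-p1` g2. THEOREMS ONLY; the published
input is the Literature fact of §0 (cited, never asserted). No `sorry`; nothing is closed: the stub TDS
of `Cruxes/ManinFrameResidueProperR/Lines/birth.lean` (v1.1) is Manin's `p`-part on Edixhoven's
exceptional locus (pot-ordinary II/III/IV, `p ≥ 11`) = Edixhoven 1991 §4 "case 2" (equivalence:
p540328), open in print. This file turns the crux-idea `kato-kp-unit-twist` of cell `bsd-f2-manin`
(evidence #13 on stmt-20483) into a kernel-checked CONDITIONAL line: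
**TDS at `(W, p)` ⟸ [fact: Kato–Kosters–Pannekoek Néron integrality] ∧ [K4: the optimal member has one
quadratic twist `χ`, conductor prime to `pN`, whose `N`-imprimitive Birch–Manin value in the units
`Ω^±_f` of the NEWFORM is a `p`-unit].** The lever meets no integral model of `X₀(p²N′)`, no `deg φ`
(the residue clause voiding Česnavičius–Neururer–Saha is irrelevant) and no Kodaira type: Kato's
`_{c,d}z_m^{(p)}` are integral in `H¹(ℤ[ζ_m,1/p], V_{O_λ}(f)(1))` ((8.1.3)) with `exp*` = zeta modular
form (Thm. 9.7, `χ`-parts `T·L_S(f,χ,1)/period` by Thm. 6.6); at an additive `p > 7` the receptacle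
over the unramified `K_v ∣ p` of `ℚ(ζ_m)` is `O_v ω_E` (Kim–Nakamura Cor. 2.4 ⟸ Kosters–Pannekoek Thm. 1);
with `E[p]` irreducible the lattice is `T_pE` of any member and, `γ` and `ω` both on `E`, the Manin
constant cancels. So the `N`-imprimitive value `τ(χ)L(E,χ,1)∏_{ℓ∥N}(ℓ − a_ℓχ(ℓ))` is `p`-integral
against the NÉRON period of every member (§0, the fact); at the optimal member (`Λ_{E₀} = c₀Λ_f`, Néron period
`= |c₀|Ω^±_f` up to a factor dividing `2`, tree theorems `SkinnerUrban2014.exists_dvd_two_mul_…`) the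
value in `f`-units is `c₀ ×` (a `p`-integer), so ONE unit value forces `p ∤ c₀` (§2), which the
predecessor showed to imply TDS (`twistDegreeStep_of_exists_member_not_dvd_c`, modularity only) (§3).
* §1 `padicValRat_eq_neg_of_mul_realPeriodRat_eq` / `…imaginaryPeriodRat…` — lattice-optimal datum:
  any `ϖ` with `ϖ·Ω(W) = Ω⁺_f` (resp. `ϖ·|Ω⁻(W)| = Ω⁻_f`) has `ord_p ϖ = −ord_p c` (odd `p`).
* §2 `not_dvd_c_of_unitQuadraticTwist` — fact + lattice-optimal datum of a minimal `W₀` (additive at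
  `p > 7`, `E[p]` irreducible) + ONE unit twist (even: plus sum; odd: minus sum) ⟹ `p ∤ c(D₀)`.
* §3 `exists_member_not_dvd_c_of_unitQuadraticTwist`, `twistDegreeStep_of_unitQuadraticTwist` — at an
  AKR frame (`p ≥ 11`, `Addv`, `Irr`, newform `f`) with K4 AT THE FRAME (data `(χ, r)` for `f` and
  `a_ℓ(W)`): the member statement of line `birth`, resp. the conclusion of TDS for every `(V, W♭, C)`.
* §4 `forall_latticeOptimal_not_dvd_c_of_unitQuadraticTwist` — the per-curve certificate: K4 at the
  frame ⟹ `p ∤ c₀` for EVERY lattice-optimal datum of every minimal member (`p > 7`, additive, Irr).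
HONEST STATUS. The fact is a DERIVED READING of printed theorems, in the format of the sibling
`Kato2004.rankZero_padicValNat_sha_le_of_additive_potGood_of_imageContainsSL2` but WITHOUT a Manin
binder (the point); delicate step = the period bookkeeping (cell `bsd-f2-manin` audit K1: clean). K4 is
decidable per curve (es g2, kit j283793: 273/273 optimal curves, `p ≥ 11`, `p² ∣ N ≤ 2400`, `|d| ≤ 152`)
and OPEN uniformly (mod-`p` non-vanishing of quadratic-twist values at a level divisible by `p²`);
gain: a Hecke-free sufficient condition for TDS and a per-curve Manin certificate at additive `p > 7`.
-/

set_option autoImplicit false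
-- the Theorems directory repeats the summit name (sibling precedent `SignedBaseChangeAssembly.lean`)
set_option linter.dupNamespace false

noncomputable section

open scoped Classical

open WeierstrassCurve NumberField Literature.NumberTheory.EllipticCurves
  Literature.NumberTheory.EllipticCurves.ModularForms
  Literature.NumberTheory.EllipticCurves.Rank1Residual
  Literature.NumberTheory.DiophantineGeometry IsDedekindDomain Rat.HeightOneSpectrum
  Summit.BirchSwinnertonDyer.Rank1Residual Summit.BirchSwinnertonDyer.Rank1Residual.Additive
  CongruenceSubgroup

namespace Summit.BirchSwinnertonDyer.BirchSwinnertonDyer.Theorems.ManinFrameResidueProperRUnitTwist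

/-! ### §0 The published input is the Literature fact
`Literature.NumberTheory.EllipticCurves.kato_neron_padicValRat_twistedSymbolSum_nonneg_of_additive`
(`KatoAdditiveTwistedValueNeronIntegrality.lean`: Kato (8.1.3)/9.7/6.6 + Kim–Nakamura 2.1/2.4 +
Kosters–Pannekoek Thm. 1 read in Néron units at an additive `p > 7`; no Manin binder), taken as the
hypothesis `hK` below. -/

/-! ### §1 Lattice-optimal data: the period scalar `ϖ` has `ord_p ϖ = −ord_p c` at odd `p` -/

section Varpi

variable {W : WeierstrassCurve ℚ} [W.IsElliptic] {N : ℕ} [NeZero N] {p : ℕ} [hp : Fact p.Prime]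

/-- `ord_p` of a natural number dividing `2` vanishes at an odd prime (plumbing). [folklore] -/
private theorem padicValRat_natCast_eq_zero_of_dvd_two (hp2 : p ≠ 2) {m : ℕ} (hm : m ∣ 2) :
    padicValRat p (m : ℚ) = 0 := by
  rw [padicValRat.of_nat]
  have h : padicValNat p m = 0 := by
    refine padicValNat.eq_zero_of_not_dvd fun h ↦ hp2 ?_
    have h2 : p ∣ 2 := dvd_trans h hm
    exact (Nat.prime_dvd_prime_iff_eq hp.out Nat.prime_two).mp h2
  exact_mod_cast h

/-- **The common algebra.** If `Ω > 0`, `P > 0`, `m · Ω = |c| · P` with `m ∣ 2`, `c ≠ 0`, and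
`ϖ · Ω = P` for a rational `ϖ`, then `ord_p ϖ = −ord_p c` at an odd prime `p` (`ϖ |c| = m`). [folklore] -/
private theorem padicValRat_eq_neg_of_scalar (hp2 : p ≠ 2) {Ω P : ℝ} (hΩ : 0 < Ω) (hP : 0 < P) {c : ℤ}
    (hc0 : c ≠ 0) {m : ℕ} (hm2 : m ∣ 2) (hm : (m : ℝ) * Ω = |(c : ℝ)| * P) {ϖ : ℚ}
    (hϖ : (ϖ : ℝ) * Ω = P) : padicValRat p ϖ = -padicValRat p (c : ℚ) := by
  have key : (ϖ : ℝ) * |(c : ℝ)| = m := by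
    have h1 : (m : ℝ) * Ω = |(c : ℝ)| * ((ϖ : ℝ) * Ω) := by rw [hϖ]; exact hm
    have h2 : ((ϖ : ℝ) * |(c : ℝ)| - m) * Ω = 0 := by
      have := h1; ring_nf; ring_nf at this; linarith
    rcases mul_eq_zero.mp h2 with h | h
    · linarith
    · exact absurd h hΩ.ne'
  have keyℚ : ϖ * |(c : ℚ)| = (m : ℚ) := by
    have : ((ϖ * |(c : ℚ)| : ℚ) : ℝ) = ((m : ℚ) : ℝ) := by push_cast; exact key
    exact_mod_cast this
  have hϖ0 : ϖ ≠ 0 := by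
    rintro rfl
    rw [Rat.cast_zero, zero_mul] at hϖ
    exact hP.ne' hϖ.symm
  have habs0 : |(c : ℚ)| ≠ 0 := abs_ne_zero.mpr (by exact_mod_cast hc0)
  have hval : padicValRat p ϖ + padicValRat p |(c : ℚ)| = 0 := by
    rw [← padicValRat.mul hϖ0 habs0, keyℚ, padicValRat_natCast_eq_zero_of_dvd_two hp2 hm2]
  have habs : padicValRat p |(c : ℚ)| = padicValRat p (c : ℚ) := by
    rcases abs_choice (c : ℚ) with h | h
    · rw [h]
    · rw [h, padicValRat.neg]
  linarith

/-- **Plus side.** For a lattice-optimal datum `D` (`Λ_E = c Λ_f`) of `W` and ANY `ϖ ∈ ℚ` with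
`ϖ · Ω(W) = Ω⁺_f`: `ord_p ϖ = −ord_p c` at an odd prime `p` — from the tree theorem
`m · Ω(W) = |c| · Ω⁺_f`, `m ∣ 2` (`SkinnerUrban2014.exists_dvd_two_mul_realPeriodRat_eq_of_latticeEq`;
Edixhoven 1991 §1, Cremona §2.8) and `Ω(W), Ω⁺_f > 0`. [cite: EdixhovenManin1991, §1]
[cite: CremonaAlgorithms1997, §2.8 (p. 26)] -/
theorem padicValRat_eq_neg_of_mul_realPeriodRat_eq (hp2 : p ≠ 2) (D : ModularParametrizationData W N)
    (hopt : ∀ z ∈ D.L.lattice, ∃ w ∈ periodLattice D.f, z = D.c * w) {ϖ : ℚ}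
    (hϖ : (ϖ : ℝ) * W.realPeriodRat = plusPeriod D.f) :
    padicValRat p ϖ = -padicValRat p (D.c : ℚ) := by
  obtain ⟨m, hm2, hm⟩ := SkinnerUrban2014.exists_dvd_two_mul_realPeriodRat_eq_of_latticeEq D hopt
  exact padicValRat_eq_neg_of_scalar hp2 W.realPeriodRat_pos_holds
    (IsNewform0.plusPeriod_pos_holds D.isNewformOf.1 D.isNewformOf.coeffField_eq_bot)
    D.maninConstant_ne_zero_holds hm2 hm hϖ

/-- **Minus side.** For a lattice-optimal datum `D` of `W` and ANY `ϖ ∈ ℚ` with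
`ϖ · |Ω⁻(W)| = Ω⁻_f`: `ord_p ϖ = −ord_p c` at an odd prime `p` — from the tree theorem
`m · |Ω⁻(W)| = |c| · Ω⁻_f`, `m ∣ 2`
(`SkinnerUrban2014.exists_dvd_two_mul_imaginaryPeriodRat_eq_of_latticeEq`) and `|Ω⁻(W)|, Ω⁻_f > 0`.
[cite: EdixhovenManin1991, §1] [cite: Pal2012, p. 1514] -/
theorem padicValRat_eq_neg_of_mul_imaginaryPeriodRat_eq (hp2 : p ≠ 2)
    (D : ModularParametrizationData W N)
    (hopt : ∀ z ∈ D.L.lattice, ∃ w ∈ periodLattice D.f, z = D.c * w) {ϖ : ℚ}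
    (hϖ : (ϖ : ℝ) * W.imaginaryPeriodRat = minusPeriod D.f) :
    padicValRat p ϖ = -padicValRat p (D.c : ℚ) := by
  obtain ⟨m, hm2, hm⟩ :=
    SkinnerUrban2014.exists_dvd_two_mul_imaginaryPeriodRat_eq_of_latticeEq D hopt
  exact padicValRat_eq_neg_of_scalar hp2 W.imaginaryPeriodRat_pos
    (IsNewform0.minusPeriod_pos_holds D.isNewformOf.1 D.isNewformOf.coeffField_eq_bot)
    D.maninConstant_ne_zero_holds hm2 hm hϖ

/-- `p ∤ c` from `ord_p c ≤ 0` for a non-zero integer `c` (plumbing). [folklore] -/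
private theorem not_dvd_of_padicValRat_le_zero {c : ℤ} (hc : c ≠ 0)
    (h : padicValRat p (c : ℚ) ≤ 0) : ¬ (p : ℤ) ∣ c := by
  intro hdvd
  rw [padicValRat.of_int] at h
  have h1 : (padicValInt p c : ℤ) ≤ 0 := by exact_mod_cast h
  have h2 : padicValInt p c = 0 := by
    have := padicValInt p c
    omega
  rw [padicValInt, padicValNat.eq_zero_iff] at h2
  rcases h2 with h2 | h2 | h2
  · exact hp.out.one_lt.ne' h2
  · exact (Int.natAbs_eq_zero.not.mpr hc) h2
  · exact h2 (Int.natCast_dvd.mp hdvd)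

end Varpi

/-! ### §2 One unit twist at the optimal member forces `p ∤ c₀` (granted the fact) -/

section UnitTwist

variable {p : ℕ} [hp : Fact p.Prime]

/-- **`p ∤ c₀` from ONE `p`-unit quadratic twist, granted Kato–Kosters–Pannekoek Néron integrality.**
Let `W₀/ℚ` be globally minimal, additive at a prime `p > 7` with `E[p]` irreducible, and `D₀` a
LATTICE-OPTIMAL datum (`Λ_{E₀} = c₀ Λ_f`: the optimal curve with its optimal parametrisation) at any
level `N`. Suppose some primitive non-trivial quadratic `χ` of conductor `m` prime to `pN` has
`N`-imprimitive Birch–Manin value `∏_{ℓ ∥ N}(ℓ − a_ℓχ(ℓ)) · Σ_a χ(a){∞,a/m}_f = r · Ω⁺_f` (even `χ`) or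
`= r · Ω⁻_f · i` (odd `χ`) with `r ∈ ℚ`, `r ≠ 0`, `ord_p r ≤ 0` (hypothesis K4 of the cell
`bsd-f2-manin`, decidable per curve). Then `p ∤ c₀`: the fact gives `0 ≤ ord_p(ϖ r)` for the period
scalar `ϖ` with `ϖ Ω(W₀) = Ω⁺_f` (resp. `ϖ|Ω⁻(W₀)| = Ω⁻_f`), and `ord_p ϖ = −ord_p c₀` (§1), so
`ord_p c₀ ≤ ord_p r ≤ 0`. [cite: Kato2004Asterisque, (8.1.3) (p. 180) and Thm. 9.7 (p. 189)]
[cite: KimNakamura2020, Cor. 2.4] [cite: KostersPannekoek2017, Thm. 1] -/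
theorem not_dvd_c_of_unitQuadraticTwist
    (hK : kato_neron_padicValRat_twistedSymbolSum_nonneg_of_additive)
    (W₀ : WeierstrassCurve ℚ) [W₀.IsElliptic] [W₀.IsGloballyMinimal] {N : ℕ} [NeZero N]
    (D₀ : ModularParametrizationData W₀ N)
    (hopt : ∀ z ∈ D₀.L.lattice, ∃ w ∈ periodLattice D₀.f, z = D₀.c * w) (hp7 : 7 < p)
    (hadd : Addv W₀ p) (hirr : Irr W₀ p) {m : ℕ} [NeZero m] (hm : m.Coprime (p * N))
    (χ : DirichletCharacter ℂ m) (hχ : χ.IsPrimitive) (hχ1 : χ ≠ 1) (hχ2 : MulChar.IsQuadratic χ)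
    {r : ℚ} (hr0 : r ≠ 0) (hr : padicValRat p r ≤ 0)
    (hval : (χ.Even ∧
        (∏ ℓ ∈ N.primeFactors with ¬ ℓ ^ 2 ∣ N, ((ℓ : ℂ) - (W₀.LFunction ℓ : ℂ) * χ (ℓ : ZMod m))) *
          twistedSymbolSum D₀.f χ = (r : ℂ) * (plusPeriod D₀.f : ℂ)) ∨
      (χ.Odd ∧
        (∏ ℓ ∈ N.primeFactors with ¬ ℓ ^ 2 ∣ N, ((ℓ : ℂ) - (W₀.LFunction ℓ : ℂ) * χ (ℓ : ZMod m))) *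
          twistedSymbolSum D₀.f χ = (r : ℂ) * (minusPeriod D₀.f : ℂ) * Complex.I)) :
    ¬ (p : ℤ) ∣ D₀.c := by
  have hp2 : p ≠ 2 := by omega
  have hc0 : D₀.c ≠ 0 := D₀.maninConstant_ne_zero_holds
  refine not_dvd_of_padicValRat_le_zero hc0 ?_
  rcases hval with ⟨heven, hv⟩ | ⟨hodd, hv⟩
  · -- even twist: `ϖ = Ω⁺_f / Ω(W₀)`
    have hΩ : 0 < W₀.realPeriodRat := W₀.realPeriodRat_pos_holds
    obtain ⟨mm, -, hmm⟩ := SkinnerUrban2014.exists_dvd_two_mul_realPeriodRat_eq_of_latticeEq D₀ hopt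
    -- the scalar `ϖ := mm / |c|` is rational and satisfies `ϖ Ω = Ω⁺_f`
    set ϖ : ℚ := (mm : ℚ) / |(D₀.c : ℚ)| with hϖdef
    have habs0 : |(D₀.c : ℝ)| ≠ 0 := abs_ne_zero.mpr (by exact_mod_cast hc0)
    have hϖ : (ϖ : ℝ) * W₀.realPeriodRat = plusPeriod D₀.f := by
      rw [hϖdef]; push_cast
      rw [div_mul_eq_mul_div, hmm]
      field_simp
    have h0 := (hK W₀ D₀.f D₀.isNewformOf p hp7 hadd.1 hadd.2 hirr m hm χ hχ hχ1 hχ2 ϖ r).1 heven hϖ hv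
    have hϖ0 : ϖ ≠ 0 := by
      intro h
      rw [h, Rat.cast_zero, zero_mul] at hϖ
      exact (IsNewform0.plusPeriod_pos_holds D₀.isNewformOf.1 D₀.isNewformOf.coeffField_eq_bot).ne'
        hϖ.symm
    rw [padicValRat.mul hϖ0 hr0, padicValRat_eq_neg_of_mul_realPeriodRat_eq hp2 D₀ hopt hϖ] at h0
    linarith
  · -- odd twist: `ϖ = Ω⁻_f / |Ω⁻(W₀)|`
    have hΩ : 0 < W₀.imaginaryPeriodRat := W₀.imaginaryPeriodRat_pos
    obtain ⟨mm, -, hmm⟩ :=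
      SkinnerUrban2014.exists_dvd_two_mul_imaginaryPeriodRat_eq_of_latticeEq D₀ hopt
    set ϖ : ℚ := (mm : ℚ) / |(D₀.c : ℚ)| with hϖdef
    have habs0 : |(D₀.c : ℝ)| ≠ 0 := abs_ne_zero.mpr (by exact_mod_cast hc0)
    have hϖ : (ϖ : ℝ) * W₀.imaginaryPeriodRat = minusPeriod D₀.f := by
      rw [hϖdef]; push_cast
      rw [div_mul_eq_mul_div, hmm]
      field_simp
    have h0 := (hK W₀ D₀.f D₀.isNewformOf p hp7 hadd.1 hadd.2 hirr m hm χ hχ hχ1 hχ2 ϖ r).2 hodd hϖ hv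
    have hϖ0 : ϖ ≠ 0 := by
      intro h
      rw [h, Rat.cast_zero, zero_mul] at hϖ
      exact (IsNewform0.minusPeriod_pos_holds D₀.isNewformOf.1 D₀.isNewformOf.coeffField_eq_bot).ne'
        hϖ.symm
    rw [padicValRat.mul hϖ0 hr0, padicValRat_eq_neg_of_mul_imaginaryPeriodRat_eq hp2 D₀ hopt hϖ] at h0
    linarith

end UnitTwist

/-! ### §3 At an AKR residue frame: the member statement of line `birth` and TDS, from K4 at the optimal member -/

section Frame

variable {p : ℕ} [hp : Fact p.Prime]

/-- A lattice-optimal datum at level `N` is one at any level `M = N` (`subst`; plumbing). [folklore] -/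
private theorem exists_latticeOptimal_of_level_eq {W₀ : WeierstrassCurve ℚ} {N M : ℕ} [NeZero N]
    [NeZero M] (h : N = M) (D : ModularParametrizationData W₀ N)
    (hopt : ∀ z ∈ D.L.lattice, ∃ w ∈ periodLattice D.f, z = D.c * w) :
    ∃ D' : ModularParametrizationData W₀ M, ∀ z ∈ D'.L.lattice, ∃ w ∈ periodLattice D'.f, z = D'.c * w := by
  subst h
  exact ⟨D, hopt⟩

/-- **Hypothesis K4 at the frame, spelled out** (no new definition; it depends only on the frame curve
`W` — through `a_ℓ(W)`, `ℓ ∥ N` — and the newform `f` of its class): some primitive non-trivial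
quadratic `χ` of conductor `m` prime to `p·N(W)` has `N`-imprimitive Birch–Manin value
`∏_{ℓ ∥ N}(ℓ − a_ℓχ(ℓ)) · Σ_a χ(a){∞,a/m}_f = r Ω⁺_f` (even) / `= r Ω⁻_f i` (odd) with `r ≠ 0`,
`ord_p r ≤ 0`. GRANTED the fact and modularity, K4 at an AKR frame (`p ≥ 11`, additive, `E[p]`
irreducible) yields a globally minimal member with a level-`N(W)` datum of Manin constant prime to
`p`: the `X₀(N)`-optimal member (`X12.exists_isIsogenous_optimal`, lattice-optimal datum `D₀`,
`D₀.f = f` by multiplicity one, `a_ℓ(W₀) = a_ℓ(W)` along the isogeny) and §2. Cell `bsd-f2-manin`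
(es g2, kit j283793): K4 instance-true for all 273 optimal curves with `p ≥ 11`, `p² ∣ N ≤ 2400`
(`|d| ≤ 152`); OPEN uniformly. [cite: MazurTateTeitelbaum1986, §I.8 (8.6)] -/
theorem exists_member_not_dvd_c_of_unitQuadraticTwist
    (hK : kato_neron_padicValRat_twistedSymbolSum_nonneg_of_additive) (hnf : exists_isNewformOf)
    (W : WeierstrassCurve ℚ) [W.IsElliptic] [W.IsGloballyMinimal] [NeZero (W.conductorNorm ℤ)]
    (hp11 : 11 ≤ p) (hadd : Addv W p) (hirr : Irr W p)
    (f : CuspForm (Gamma0 (W.conductorNorm ℤ)) 2) (hf : IsNewformOf W f)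
    (hK4 : ∃ (m : ℕ) (_ : NeZero m) (χ : DirichletCharacter ℂ m) (r : ℚ),
        m.Coprime (p * W.conductorNorm ℤ) ∧ χ.IsPrimitive ∧ χ ≠ 1 ∧ MulChar.IsQuadratic χ ∧
        r ≠ 0 ∧ padicValRat p r ≤ 0 ∧
        ((χ.Even ∧
          (∏ ℓ ∈ (W.conductorNorm ℤ).primeFactors with ¬ ℓ ^ 2 ∣ W.conductorNorm ℤ,
              ((ℓ : ℂ) - (W.LFunction ℓ : ℂ) * χ (ℓ : ZMod m))) *
            twistedSymbolSum f χ = (r : ℂ) * (plusPeriod f : ℂ)) ∨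
        (χ.Odd ∧
          (∏ ℓ ∈ (W.conductorNorm ℤ).primeFactors with ¬ ℓ ^ 2 ∣ W.conductorNorm ℤ,
              ((ℓ : ℂ) - (W.LFunction ℓ : ℂ) * χ (ℓ : ZMod m))) *
            twistedSymbolSum f χ = (r : ℂ) * (minusPeriod f : ℂ) * Complex.I))) :
    ∃ (W₀ : WeierstrassCurve ℚ) (_ : W₀.IsElliptic) (_ : W₀.IsGloballyMinimal)
      (D₀ : ModularParametrizationData W₀ (W.conductorNorm ℤ)),
      IsIsogenous W W₀ ∧ ¬ (p : ℤ) ∣ D₀.c := by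
  -- the optimal member with its lattice-optimal datum, at level `N(W₀) = N(W)`
  obtain ⟨W₀, hE₀, hM₀, hNe₀, D₀', hiso, hN, hopt'⟩ := X12.exists_isIsogenous_optimal hnf W
  haveI := hE₀
  haveI := hM₀
  haveI := hNe₀
  obtain ⟨D₀, hopt⟩ := exists_latticeOptimal_of_level_eq hN D₀' hopt'
  have hiso₀ : IsIsogenous W₀ W := hiso.symm_of_charZero
  -- the optimal datum carries the newform of the class, and `a_ℓ(W₀) = a_ℓ(W)`
  have hfD : D₀.f = f :=
    eq_of_forall_cuspCoeff_eq_gamma0 fun n ↦ by rw [D₀.isNewformOf.2 n, (hf.of_isIsogenous hiso₀).2 n]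
  have hL : W₀.LFunction = W.LFunction := hiso₀.LFunction_eq
  obtain ⟨m, hm0, χ, r, hm, hχ, hχ1, hχ2, hr0, hr, hval⟩ := hK4
  haveI := hm0
  rw [← hfD, ← hL] at hval
  have hadd₀ : Addv W₀ p := (X2.addv_iff_of_isIsogenous (p := p) hiso).mp hadd
  have hirr₀ : Irr W₀ p := (X12.irr_iff_of_isIsogenous hiso p).mp hirr
  exact ⟨W₀, hE₀, hM₀, D₀, hiso,
    not_dvd_c_of_unitQuadraticTwist hK W₀ D₀ hopt (by omega) hadd₀ hirr₀ hm χ hχ hχ1 hχ2 hr0 hr hval⟩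

/-- **TDS from the Euler-system lever.** At an AKR residue frame `(W, p)` — `p ≥ 11`, additive, `E[p]`
irreducible, newform `f` — with K4 at the frame (previous theorem) and GRANTED the Kato–Kosters–Pannekoek
fact and modularity: for every unstarred (G)-ordinary globally minimal member `V ∼ W`
(`TypeGOrd V p`, `ord_p Δ_min(V) ≤ 4`) and every globally minimal model `W♭` of `V ⊗ χ_{p*}`, SOME
conductor-level datum of `V` has strictly fewer factors `p` in its modular degree than EVERY
conductor-level datum of `W♭` — the conclusion of the registered stub `stub_twistDegreeStep`
(Edixhoven 1991 §4, "case 2"), by the predecessor's `twistDegreeStep_of_exists_member_not_dvd_c`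
(p540328; modularity only). The residue clause and the degree clause `hall` of the stub are not
needed. [cite: EdixhovenManin1991, §4 (cases 1/2)] [cite: Kato2004Asterisque, Thm. 9.7 (p. 189)] -/
theorem twistDegreeStep_of_unitQuadraticTwist
    (hK : kato_neron_padicValRat_twistedSymbolSum_nonneg_of_additive) (hnf : exists_isNewformOf)
    (W : WeierstrassCurve ℚ) [W.IsElliptic] [W.IsGloballyMinimal] [NeZero (W.conductorNorm ℤ)]
    (hp11 : 11 ≤ p) (hadd : Addv W p) (hirr : Irr W p)
    (f : CuspForm (Gamma0 (W.conductorNorm ℤ)) 2) (hf : IsNewformOf W f)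
    (hK4 : ∃ (m : ℕ) (_ : NeZero m) (χ : DirichletCharacter ℂ m) (r : ℚ),
        m.Coprime (p * W.conductorNorm ℤ) ∧ χ.IsPrimitive ∧ χ ≠ 1 ∧ MulChar.IsQuadratic χ ∧
        r ≠ 0 ∧ padicValRat p r ≤ 0 ∧
        ((χ.Even ∧
          (∏ ℓ ∈ (W.conductorNorm ℤ).primeFactors with ¬ ℓ ^ 2 ∣ W.conductorNorm ℤ,
              ((ℓ : ℂ) - (W.LFunction ℓ : ℂ) * χ (ℓ : ZMod m))) *
            twistedSymbolSum f χ = (r : ℂ) * (plusPeriod f : ℂ)) ∨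
        (χ.Odd ∧
          (∏ ℓ ∈ (W.conductorNorm ℤ).primeFactors with ¬ ℓ ^ 2 ∣ W.conductorNorm ℤ,
              ((ℓ : ℂ) - (W.LFunction ℓ : ℂ) * χ (ℓ : ZMod m))) *
            twistedSymbolSum f χ = (r : ℂ) * (minusPeriod f : ℂ) * Complex.I)))
    (V : WeierstrassCurve ℚ) [V.IsElliptic] [V.IsGloballyMinimal] [NeZero (V.conductorNorm ℤ)]
    (Wf : WeierstrassCurve ℚ) [Wf.IsElliptic] [Wf.IsGloballyMinimal] [NeZero (Wf.conductorNorm ℤ)]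
    (C : VariableChange ℚ) (hisoV : IsIsogenous W V) (hG : TypeGOrd V p)
    (hV4 : padicValInt p V.minimalDiscriminantInt ≤ 4)
    (hC : C • V.quadraticTwist ((-1 : ℚ) ^ (p / 2) * p) = Wf) :
    ∃ D : ModularParametrizationData V (V.conductorNorm ℤ),
      ∀ Df : ModularParametrizationData Wf (Wf.conductorNorm ℤ),
        padicValNat p D.modularDegree < padicValNat p Df.modularDegree :=
  ManinFrameResidueProperTwistDegree.twistDegreeStep_of_exists_member_not_dvd_c hnf W (by omega) hadd
    hirr hisoV hG hV4 C hC
    (exists_member_not_dvd_c_of_unitQuadraticTwist hK hnf W hp11 hadd hirr f hf hK4)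

end Frame

/-! ### §4 The per-curve CERTIFICATE shape: K4 at the frame ⟹ `p ∤ c₀` for EVERY optimal datum (appended) -/

section Certificate

variable {p : ℕ} [hp : Fact p.Prime]

/-- **Manin's `p`-part at the optimal curve from ONE unit twist (certificate form).** For a globally
minimal `W/ℚ`, additive at a prime `p > 7` with `E[p]` irreducible, newform `f` at level `N(W)`, and
K4 data `(m, χ, r)` at the frame (a primitive non-trivial quadratic `χ` of conductor `m` prime to
`p·N(W)` with `N`-imprimitive Birch–Manin value `r·Ω⁺_f` (even) / `r·Ω⁻_f·i` (odd), `r ≠ 0`,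
`ord_p r ≤ 0` — a finite exact modular-symbol computation at level `N(W)`): EVERY lattice-optimal datum
`D₀` (`Λ_{E₀} = c₀Λ_f`) at level `N(W)` of EVERY globally minimal `W₀ ∼ W` has `p ∤ c₀` — GRANTED the
Kato–Kosters–Pannekoek fact. This is the form a compute seat consumes beyond Cremona's range (no period
lattice of `E`, no `c₀`, no modular degree needed). [cite: Kato2004Asterisque, (8.1.3) (p. 180), Thm. 9.7 (p. 189)]
[cite: KimNakamura2020, Cor. 2.4] [cite: MazurTateTeitelbaum1986, §I.8 (8.6)] -/
theorem forall_latticeOptimal_not_dvd_c_of_unitQuadraticTwist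
    (hK : kato_neron_padicValRat_twistedSymbolSum_nonneg_of_additive)
    (W : WeierstrassCurve ℚ) [W.IsElliptic] [W.IsGloballyMinimal] [NeZero (W.conductorNorm ℤ)]
    (hp7 : 7 < p) (hadd : Addv W p) (hirr : Irr W p)
    (f : CuspForm (Gamma0 (W.conductorNorm ℤ)) 2) (hf : IsNewformOf W f)
    (hK4 : ∃ (m : ℕ) (_ : NeZero m) (χ : DirichletCharacter ℂ m) (r : ℚ),
        m.Coprime (p * W.conductorNorm ℤ) ∧ χ.IsPrimitive ∧ χ ≠ 1 ∧ MulChar.IsQuadratic χ ∧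
        r ≠ 0 ∧ padicValRat p r ≤ 0 ∧
        ((χ.Even ∧
          (∏ ℓ ∈ (W.conductorNorm ℤ).primeFactors with ¬ ℓ ^ 2 ∣ W.conductorNorm ℤ,
              ((ℓ : ℂ) - (W.LFunction ℓ : ℂ) * χ (ℓ : ZMod m))) *
            twistedSymbolSum f χ = (r : ℂ) * (plusPeriod f : ℂ)) ∨
        (χ.Odd ∧
          (∏ ℓ ∈ (W.conductorNorm ℤ).primeFactors with ¬ ℓ ^ 2 ∣ W.conductorNorm ℤ,
              ((ℓ : ℂ) - (W.LFunction ℓ : ℂ) * χ (ℓ : ZMod m))) *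
            twistedSymbolSum f χ = (r : ℂ) * (minusPeriod f : ℂ) * Complex.I)))
    (W₀ : WeierstrassCurve ℚ) [W₀.IsElliptic] [W₀.IsGloballyMinimal] (hiso : IsIsogenous W W₀)
    (D₀ : ModularParametrizationData W₀ (W.conductorNorm ℤ))
    (hopt : ∀ z ∈ D₀.L.lattice, ∃ w ∈ periodLattice D₀.f, z = D₀.c * w) :
    ¬ (p : ℤ) ∣ D₀.c := by
  have hiso₀ : IsIsogenous W₀ W := hiso.symm_of_charZero
  have hfD : D₀.f = f :=
    eq_of_forall_cuspCoeff_eq_gamma0 fun n ↦ by rw [D₀.isNewformOf.2 n, (hf.of_isIsogenous hiso₀).2 n]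
  have hL : W₀.LFunction = W.LFunction := hiso₀.LFunction_eq
  obtain ⟨m, hm0, χ, r, hm, hχ, hχ1, hχ2, hr0, hr, hval⟩ := hK4
  haveI := hm0
  rw [← hfD, ← hL] at hval
  exact not_dvd_c_of_unitQuadraticTwist hK W₀ D₀ hopt hp7
    ((X2.addv_iff_of_isIsogenous (p := p) hiso).mp hadd) ((X12.irr_iff_of_isIsogenous hiso p).mp hirr)
    hm χ hχ hχ1 hχ2 hr0 hr hval

end Certificate


end Summit.BirchSwinnertonDyer.BirchSwinnertonDyer.Theorems.ManinFrameResidueProperRUnitTwist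

end
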